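import Summits.ResolutionOfSingularities.ResolutionOfSingularities.Theorems.ItineraryCutClasses
import Literature.AlgebraicGeometry.Resolution.PointBlowupMohWitnessPrimePower
import Literature.AlgebraicGeometry.Resolution.PointBlowupMohBoundPrimePower
import Literature.AlgebraicGeometry.Resolution.OrdZeroBasics
import HarnessLib

/-!
# BoundaryLedger — decomp-res lens-3 («one certified translation + split beneath»), generation 11

[WRITER NOTE (decomp-res writer g4). The lens-3 g11 node `BoundaryLedger` (CRITIC-LEDGER row «10:19Z» / line 94, CLEARED AS
DECISION NODE) is filed as THREE tree files because Theorems files with proofs are capped at 400 lines: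
`Theorems.BoundaryLedgerModel` (§§1–3: the ledger, the no-jump lemmas, rigidity of free tails — this file,
which keeps the node's
docstring verbatim below), `Theorems.BoundaryLedgerClasses` (§4 the pieces `NoCriticalFreePlateauxDeep` /
`SatDefectWalksTerminateDeep` /
`NoBareTailsDeep` / `NoLoadedCriticalPlateauxDeep`, THE ONE EQUIV, the decided cells, the 2 × 2 grid; §5 the
quantitative laws; §6 the
E-format column), both in the ONE namespace `…Theorems.BoundaryLedger` and Theses-free, and
`Theorems.MaxContactCutBoundaryLedger` (the
wiring to MaxContactCut item 31770 and to the asides `BLNoCriticalFreePlateauxDeep` / `BLNoBareTailsDeep` /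
`BLNoLoadedCriticalPlateauxDeep`
/ `BLSatDefectDeep` BY NAME).  Text below unchanged; `closes` there means the host's
`MaxContactCutExponentLadder.closes` (not restated).]

RESIDUAL MODE on the live route `MaxContactCut`: the summit-strength open piece is the deep E-format walk class
`DefectWalksTerminateDeep` (= `MaxContactCut.DefectWalksDeep`, item 31770, `Iff.rfl`).

THE ONE EQUIV (certified, `defectDeep_iff_ledger`):

  `DefectWalksTerminateDeep ⟺ NoCriticalFreePlateauxDeep ∧ SatDefectWalksTerminateDeep`.

It is earned by a CONSERVATION LAW of the forced-walk model that no earlier node uses — the **boundary-mass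
ledger** `|r_{t+1}| = κ_t + (o_t − q)` (`degree_r_succ`; `κ_t` = kept old multiplicity = the satellite mass,
`o_t = s_t + |r_t|`) — together with the **single-component no-jump lemma** (`not_jump_of_subsingleton`, from the
tree's Moh/Hauser–Perlega necessary conditions) and the **light-boundary bound** `|r| < q` on one-component states
(`degree_lt_of_subsingleton`, from isolation).  Consequences PROVED here (0 sorry):

* `satellite_of_jump_succ` — every jump is the child of a satellite move («antelopes are satellites»); hence the
  jump half of g10 sits INSIDE the satellite column (`noRecurrentJump_of_satDeep`), and the cell
  (recurrent jumps) × (eventually free) of the 2 × 2 grid itinerary × boundary is EMPTY (`noFreeJumpWalks`).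
* `free_tail_rigid` — RIGIDITY OF FREE TAILS: an infinite forced walk that is eventually free (no satellite moves
  after time `N`) is, from some later time on, the CRITICAL FREE PLATEAU: shade `≡ q` exactly, boundary mass
  `|r_t| ≡ ρ` constant with `ρ < q`, order `≡ q + ρ`.  (Sub- and super-critical free tails are impossible by the
  ledger: the mass would leave `[0, q)`.)
* the exact cut above and its refinement `critical_iff_bare_loaded` (ρ = 0: BARE tails `r ≡ 0, o ≡ q`;
  ρ ≥ 1: LOADED critical plateaux), necessity of every piece from the blocker, the by-name edges to the tree's
  `SatDefectWalksTerminate` (30256-side) and to g10's halves, and the quantitative MEAN-REVERSION law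
  `exists_shade_le_within` (in every window of `2q` consecutive stages of any forced walk some stage has shade `≤ q`).

`closes` is the host route's deciding theorem BY NAME (`MaxContactCutExponentLadder.closes`).
Tags, ports and census asks: NODE-g11.md next to this file.
-/

open MvPolynomial
open Literature.AlgebraicGeometry.Resolution
open Literature.AlgebraicGeometry.Resolution.Hauser2010
open Literature.AlgebraicGeometry.Resolution.PointBlowup
open Summit.ResolutionOfSingularities.ResolutionOfSingularities.Theorems.TightDefectClasses
open Summit.ResolutionOfSingularities.ResolutionOfSingularities.Theorems.TightDefectStrongWalks
open Summit.ResolutionOfSingularities.ResolutionOfSingularities.Theorems.ItineraryCutClasses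

namespace Summit.ResolutionOfSingularities.ResolutionOfSingularities.Theorems.BoundaryLedger

/-! ## §1 The boundary-mass ledger of a forced walk -/

section Ledger

variable {K : Type} [Field K] [DecidableEq K] {q : ℕ} {s₀ : State (Fin 3) K}

/-- The KEPT multiplicities at step `t`: old components other than the chart variable on which the next point
lies (`b_t i = 0`).  DEFINITION (support). -/
noncomputable def kept (W : ForcedWalk q s₀) (t : ℕ) : Fin 3 →₀ ℕ :=
  ((W.st t).r.filter (fun i => W.b t i = 0)).erase (W.j t)

/-- The kept mass at coordinate `i`. [folklore] -/
theorem kept_apply (W : ForcedWalk q s₀) (t : ℕ) (i : Fin 3) :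
    kept W t i = if i ≠ W.j t ∧ W.b t i = 0 then (W.st t).r i else 0 := by
  classical
  unfold kept
  by_cases hij : i = W.j t
  · simp [hij]
  · rw [Finsupp.erase_ne hij, Finsupp.filter_apply]
    by_cases hb : W.b t i = 0
    · simp [hb, hij]
    · simp [hb]

/-- A step is a SATELLITE move iff it keeps some positive old multiplicity. [folklore] -/
theorem satellite_iff_kept_ne_zero (W : ForcedWalk q s₀) (t : ℕ) : W.Satellite t ↔ kept W t ≠ 0 := by
  classical
  constructor
  · rintro ⟨i, hij, hb, hr⟩ h0
    have h1 : kept W t i = (W.st t).r i := by rw [kept_apply, if_pos ⟨hij, hb⟩]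
    rw [h0, Finsupp.coe_zero, Pi.zero_apply] at h1
    omega
  · intro h
    obtain ⟨i, hi⟩ : ∃ i, kept W t i ≠ 0 := by
      by_contra hall
      push Not at hall
      exact h (Finsupp.ext hall)
    rw [kept_apply] at hi
    by_cases hc : i ≠ W.j t ∧ W.b t i = 0
    · rw [if_pos hc] at hi
      exact ⟨i, hc.1, hc.2, Nat.pos_of_ne_zero hi⟩
    · rw [if_neg hc] at hi
      exact absurd rfl hi

/-- **THE LEDGER (PROVED).** The new multiplicity vector is the kept part plus the new exceptional component of
multiplicity `o_t − q`. [folklore] (Sources: Hauser2010 §D, transformation of the exceptional multiplicities.) -/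
theorem r_succ_eq (W : ForcedWalk q s₀) (t : ℕ) {o : ℕ} (ho : ordZero (W.st t).F = o) :
    (W.st (t + 1)).r = kept W t + Finsupp.single (W.j t) (o - q) := by
  classical
  rw [W.st_succ]
  show newMult q (W.j t) (W.b t) (W.st t) = _
  rw [newMult_eq q (W.j t) (W.b t) (W.onExc t) (W.st t) ho,
    filter_update_of_pos (W.st t).r (Z := fun i => W.b t i = 0) (W.onExc t),
    Finsupp.update_eq_erase_add_single]
  rfl

/-- **Boundary-mass ledger (PROVED):** `|r_{t+1}| = κ_t + (o_t − q)`. [folklore] -/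
theorem degree_r_succ (W : ForcedWalk q s₀) (t : ℕ) {o : ℕ} (ho : ordZero (W.st t).F = o) :
    (W.st (t + 1)).r.degree = (kept W t).degree + (o - q) := by
  rw [r_succ_eq W t ho, map_add, Finsupp.degree_single]

/-- After a FREE move the boundary is the single new component. [folklore] -/
theorem r_succ_of_not_satellite (W : ForcedWalk q s₀) (t : ℕ) {o : ℕ} (ho : ordZero (W.st t).F = o)
    (hfree : ¬ W.Satellite t) : (W.st (t + 1)).r = Finsupp.single (W.j t) (o - q) := by
  have hk : kept W t = 0 := by
    by_contra h
    exact hfree ((satellite_iff_kept_ne_zero W t).mpr h)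
  rw [r_succ_eq W t ho, hk, zero_add]

/-- ℕ-bookkeeping of a state along a walk from a root: `o_t = s_t + |r_t|` (the boundary monomial divides an
initial monomial, so `|r_t| ≤ o_t`). [folklore] -/
theorem order_eq_shade_add_degree (hroot : IsRoot q s₀) (W : ForcedWalk q s₀) (t : ℕ) {o : ℕ}
    (ho : ordZero (W.st t).F = o) :
    ∃ s : ℕ, (W.st t).shade = (s : ℕ∞) ∧ o = s + (W.st t).r.degree := by
  classical
  obtain ⟨⟨d, hd, hdeg⟩, -⟩ := (ordZero_eq_nat_iff _ _).mp ho
  have hle : (W.st t).r.degree ≤ o := by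
    have h1 : (W.st t).r ≤ d := walk_r hroot W t d (MvPolynomial.mem_support_iff.mpr hd)
    have h2 := degree_le_degree_of_le h1
    omega
  refine ⟨o - (W.st t).r.degree, shade_eq_of_ordZero_eq _ ho, by omega⟩

end Ledger

/-! ## §2 Single-component states do not jump; every jump is the child of a satellite move -/

section Jumps

variable {p e : ℕ} {K : Type} [Field K] [CharP K p] [DecidableEq K] {s₀ : State (Fin 3) K}

/-- **Single-component no-jump (PROVED).**  If at most one old component carries positive multiplicity at time
`n`, the shade does not increase at `n`: a jump needs `q ∣ o` and `q ∣ d₀ k` for every variable `k` off the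
positive boundary (tree `necessary_of_shadeIncreases_pow` (i), `pow_dvd_apply_of_shadeIncreases_of_nonexceptional`),
and an initial monomial `d₀` with `¬ q ∣ d₀ i₀` ON the boundary; with a single boundary variable the degree count
`q ∣ |d₀| = d₀ i₀ + Σ_{k ≠ i₀} d₀ k` is contradictory.  (Hauser's kangaroo conditions need TWO non-resonant
exceptional exponents; this is their contrapositive in the cleaned prime-power model.)
(Sources: Hauser2010 §G; HauserPerlega2019 §3.) [folklore] -/
theorem not_jump_of_subsingleton (hp : p.Prime) (hroot : IsRoot (p ^ e) s₀) (W : ForcedWalk (p ^ e) s₀) (n : ℕ)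
    (h1 : ∀ i k, (W.st n).r i ≠ 0 → (W.st n).r k ≠ 0 → i = k) :
    ¬ (W.st n).shade < (W.st (n + 1)).shade := by
  classical
  haveI : Fact p.Prime := ⟨hp⟩
  intro hinc
  obtain ⟨o, ho, hqo⟩ := walk_nat hroot W n
  have hinc' : ShadeIncreases (p ^ e) (W.j n) (W.b n) (W.st n) := by
    unfold ShadeIncreases
    rw [← W.st_succ]
    exact hinc
  obtain ⟨hdvd, -, i₀, -, -, hri₀, d₀, hd₀, hd₀deg, hd₀i⟩ :=
    necessary_of_shadeIncreases_pow p (W.j n) (W.b n) (W.onExc n) (W.st n) (walk_clean hroot W n) ho hqo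
      (walk_r hroot W n) hinc'
  have hother : ∀ k, k ≠ i₀ → p ^ e ∣ d₀ k := by
    intro k hk
    have hrk : (W.st n).r k = 0 := by
      by_contra h
      exact hk (h1 k i₀ h hri₀)
    exact pow_dvd_apply_of_shadeIncreases_of_nonexceptional p (W.j n) (W.b n) (W.onExc n) (W.st n) ho hqo
      (walk_r hroot W n) hinc' hrk hd₀ hd₀deg
  apply hd₀i
  have hsum : d₀.degree = d₀ i₀ + ∑ k ∈ Finset.univ.erase i₀, d₀ k := degree_eq_add_sum_erase i₀ d₀
  have h2 : p ^ e ∣ ∑ k ∈ Finset.univ.erase i₀, d₀ k :=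
    Finset.dvd_sum fun k hk => hother k (Finset.ne_of_mem_erase hk)
  have h3 : p ^ e ∣ d₀ i₀ + ∑ k ∈ Finset.univ.erase i₀, d₀ k := by
    rw [← hsum, hd₀deg]
    exact hdvd
  exact (Nat.dvd_add_left h2).mp h3

omit [CharP K p] in
/-- After a FREE move the next state has a single boundary component (PROVED). [folklore] -/
theorem subsingleton_succ_of_not_satellite (hroot : IsRoot (p ^ e) s₀) (W : ForcedWalk (p ^ e) s₀) (n : ℕ)
    (hfree : ¬ W.Satellite n) :
    ∀ i k, (W.st (n + 1)).r i ≠ 0 → (W.st (n + 1)).r k ≠ 0 → i = k := by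
  classical
  obtain ⟨o, ho, -⟩ := walk_nat hroot W n
  intro i k hi hk
  rw [r_succ_of_not_satellite W n ho hfree, Finsupp.single_apply] at hi hk
  have hi' : W.j n = i := by
    by_contra h
    exact hi (if_neg h)
  have hk' : W.j n = k := by
    by_contra h
    exact hk (if_neg h)
  rw [← hi', ← hk']

/-- **«Antelopes are satellites» (PROVED).**  A jump at time `n + 1` forces the move at time `n` to be a satellite
move. (Sources: Hauser2010 §G.) [folklore] -/
theorem satellite_of_jump_succ (hp : p.Prime) (hroot : IsRoot (p ^ e) s₀) (W : ForcedWalk (p ^ e) s₀) (n : ℕ)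
    (hinc : (W.st (n + 1)).shade < (W.st (n + 1 + 1)).shade) : W.Satellite n := by
  by_contra hfree
  exact not_jump_of_subsingleton hp hroot W (n + 1) (subsingleton_succ_of_not_satellite hroot W n hfree) hinc

/-- **Recurrent jumps force recurrent satellite moves (PROVED).** [folklore] -/
theorem satellite_io_of_recurrentJumps (hp : p.Prime) (hroot : IsRoot (p ^ e) s₀) (W : ForcedWalk (p ^ e) s₀)
    (hR : RecurrentJumps (fun i => (W.st i).shade)) : ∀ N : ℕ, ∃ i, N ≤ i ∧ W.Satellite i := by
  intro N
  obtain ⟨t, ht, hj⟩ := hR (N + 1)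
  obtain ⟨n, rfl⟩ : ∃ n, t = n + 1 := ⟨t - 1, by omega⟩
  exact ⟨n, by omega, satellite_of_jump_succ hp hroot W n hj⟩

/-- **The EMPTY CELL (PROVED): no forced walk (any exponent) is eventually free AND jumps infinitely often.**
[folklore] -/
theorem noFreeJumpWalks (hp : p.Prime) (hroot : IsRoot (p ^ e) s₀) (W : ForcedWalk (p ^ e) s₀)
    (hfree : ∃ N, ∀ t, N ≤ t → ¬ W.Satellite t) (hR : RecurrentJumps (fun i => (W.st i).shade)) : False := by
  obtain ⟨N, hN⟩ := hfree
  obtain ⟨i, hi, hs⟩ := satellite_io_of_recurrentJumps hp hroot W hR N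
  exact hN i hi hs

end Jumps

/-! ## §3 Rigidity of free tails: the critical free plateau -/

section Rigidity

variable {K : Type} [Field K] [DecidableEq K] {q : ℕ} {s₀ : State (Fin 3) K}

/-- **Light boundary on one-component states (PROVED from isolation):** `|r| < q`. [folklore] -/
theorem degree_lt_of_subsingleton (W : ForcedWalk q s₀) (hroot : IsRoot q s₀) (n : ℕ) (hq : 0 < q)
    (h1 : ∀ i k, (W.st n).r i ≠ 0 → (W.st n).r k ≠ 0 → i = k) : (W.st n).r.degree < q := by
  classical
  by_cases h0 : (W.st n).r = 0
  · rw [h0, map_zero]; exact hq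
  · obtain ⟨i, hi⟩ : ∃ i, (W.st n).r i ≠ 0 := by
      by_contra hall
      push Not at hall
      exact h0 (Finsupp.ext hall)
    have aux : ∀ i : Fin 3, ∃ k : Fin 3, i ≠ k := by decide
    obtain ⟨k, hik⟩ := aux i
    have hrk : (W.st n).r k = 0 := by
      by_contra h
      exact hik (h1 i k hi h)
    have hsum := degree_eq_add_sum_erase i (W.st n).r
    have hrest : ∑ l ∈ Finset.univ.erase i, (W.st n).r l = 0 := by
      refine Finset.sum_eq_zero fun l hl => ?_
      by_contra h
      exact Finset.ne_of_mem_erase hl (h1 l i h hi)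
    have hlt := pair_lt_of_isolatedTop (W.isolated n) i k hik (X_pow_mul_X_pow_dvd_of_forall_le (walk_r hroot W n) hik)
    omega

/-- The ledger arithmetic (PROVED): a bounded non-negative sequence with constant drift `s − q` has `s = q` and is
constant. [folklore] -/
theorem ledger_arith (n : ℕ → ℕ) (s q N : ℕ) (hstep : ∀ t, N ≤ t → n (t + 1) + q = s + n t)
    (hlt : ∀ t, N ≤ t → n t < q) : s = q ∧ ∀ t, N ≤ t → n t = n N := by
  have key : ∀ m, n (N + m) + m * q = m * s + n N := by
    intro m
    induction m with
    | zero => simp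
    | succ m ih =>
      have h1 := hstep (N + m) (Nat.le_add_right N m)
      rw [show N + (m + 1) = N + m + 1 by omega, Nat.succ_mul, Nat.succ_mul]
      omega
  have hsq : s = q := by
    rcases Nat.lt_or_ge q s with hgt | hle
    · -- supercritical: the mass grows by ≥ 1 per step and leaves [0, q)
      have h1 := key q
      have h2 := hlt (N + q) (Nat.le_add_right N q)
      have h3 : q * q + q ≤ q * s := by
        have : q * (q + 1) ≤ q * s := Nat.mul_le_mul_left q hgt
        rwa [Nat.mul_succ] at this
      omega
    · rcases Nat.lt_or_ge s q with hlt' | hge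
      · -- subcritical: the mass drops by ≥ 1 per step and leaves [0, q) from below
        have h1 := key (n N + 1)
        have h3 : (n N + 1) * s + (n N + 1) ≤ (n N + 1) * q := by
          have : (n N + 1) * (s + 1) ≤ (n N + 1) * q := Nat.mul_le_mul_left _ hlt'
          rwa [Nat.mul_succ] at this
        omega
      · omega
  refine ⟨hsq, fun t ht => ?_⟩
  obtain ⟨m, rfl⟩ := Nat.exists_eq_add_of_le ht
  have h1 := key m
  subst hsq
  omega

/-- **RIGIDITY OF FREE TAILS (PROVED).**  An infinite forced walk at exponent `q = pᵉ` (`e ≥ 1`) from a root that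
is eventually FREE (no satellite move after time `N`) is, from some later time on, the CRITICAL FREE PLATEAU: no
satellite moves, shade exactly `q`, boundary mass `|r_t| = ρ` constant with `ρ < q`, and order exactly `q + ρ`.
Mechanism: single-component no-jump (§2) ⇒ the shade is eventually constant `= s`; the ledger then reads
`|r_{t+1}| + q = s + |r_t|` with `0 ≤ |r_t| < q` (light boundary), which forces `s = q` and `|r|` constant.
(Sources: Hauser2010 §§D,G; Moh1987.) [folklore] -/
theorem free_tail_rigid {p e : ℕ} [CharP K p] (hp : p.Prime) {s₀ : State (Fin 3) K}
    (hroot : IsRoot (p ^ e) s₀) (W : ForcedWalk (p ^ e) s₀) (hfree : ∃ N, ∀ t, N ≤ t → ¬ W.Satellite t) :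
    ∃ N ρ : ℕ, ρ < p ^ e ∧ ∀ t, N ≤ t → ¬ W.Satellite t ∧ (W.st t).shade = ((p ^ e : ℕ) : ℕ∞) ∧
      (W.st t).r.degree = ρ ∧ ordZero (W.st t).F = ((p ^ e + ρ : ℕ) : ℕ∞) := by
  classical
  obtain ⟨N, hN⟩ := hfree
  have hq : 0 < p ^ e := Nat.pos_of_ne_zero (pow_ne_zero e hp.ne_zero)
  -- (1) single-component states from time N + 1 on
  have hsub : ∀ t, N + 1 ≤ t → ∀ i k, (W.st t).r i ≠ 0 → (W.st t).r k ≠ 0 → i = k := by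
    intro t ht
    obtain ⟨n, rfl⟩ : ∃ n, t = n + 1 := ⟨t - 1, by omega⟩
    exact subsingleton_succ_of_not_satellite hroot W n (hN n (by omega))
  -- (2) no jumps from time N + 1 on, hence the shade eventually stalls
  have hnj : ∀ t, N + 1 ≤ t → ¬ (W.st t).shade < (W.st (t + 1)).shade := fun t ht =>
    not_jump_of_subsingleton hp hroot W t (hsub t ht)
  have hstall : EventuallyStalls (fun k => (W.st (N + 1 + k)).shade) := by
    refine eventuallyStalls_of_not_recurrentJumps _ fun hR => ?_
    obtain ⟨t, -, hj⟩ := hR 0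
    unfold JumpAt at hj
    dsimp only at hj
    rw [show N + 1 + (t + 1) = N + 1 + t + 1 by omega] at hj
    exact hnj (N + 1 + t) (by omega) hj
  obtain ⟨M, hM⟩ := hstall
  -- the shade is constant from time N₁ := N + 1 + M on
  have hconst : ∀ t, N + 1 + M ≤ t → (W.st t).shade = (W.st (N + 1 + M)).shade := by
    intro t ht
    obtain ⟨k, rfl⟩ := Nat.exists_eq_add_of_le ht
    induction k with
    | zero => rfl
    | succ k ih =>
      have h1 := hM (M + k) (Nat.le_add_right M k)
      simp only at h1
      rw [show N + 1 + (M + k + 1) = N + 1 + M + (k + 1) by omega, show N + 1 + (M + k) = N + 1 + M + k by omega]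
        at h1
      rw [h1]
      exact ih (by omega)
  set N₁ := N + 1 + M with hN₁
  -- (3) the constant value is a natural number s
  obtain ⟨o₁, ho₁, -⟩ := walk_nat hroot W N₁
  obtain ⟨s, hs, -⟩ := order_eq_shade_add_degree hroot W N₁ ho₁
  -- (4) the ledger recursion on n_t := |r_t| for t ≥ N₁
  have hstep : ∀ t, N₁ ≤ t → (W.st (t + 1)).r.degree + p ^ e = s + (W.st t).r.degree := by
    intro t ht
    obtain ⟨o, ho, hqo⟩ := walk_nat hroot W t
    obtain ⟨s', hs', hos'⟩ := order_eq_shade_add_degree hroot W t ho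
    have hss' : s' = s := by
      have h1 := hconst t ht
      rw [hs', hs] at h1
      exact_mod_cast h1
    have hdeg := degree_r_succ W t ho
    have hk : kept W t = 0 := by
      by_contra h
      exact hN t (by omega) ((satellite_iff_kept_ne_zero W t).mpr h)
    rw [hk, map_zero, zero_add] at hdeg
    omega
  have hlt : ∀ t, N₁ ≤ t → (W.st t).r.degree < p ^ e := fun t ht =>
    degree_lt_of_subsingleton W hroot t hq (hsub t (by omega))
  obtain ⟨hsq, hρ⟩ := ledger_arith (fun t => (W.st t).r.degree) s (p ^ e) N₁ hstep hlt
  refine ⟨N₁, (W.st N₁).r.degree, hlt N₁ le_rfl, fun t ht => ⟨hN t (by omega), ?_, hρ t ht, ?_⟩⟩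
  · rw [hconst t ht, hs, hsq]
  · obtain ⟨o, ho, -⟩ := walk_nat hroot W t
    obtain ⟨s', hs', hos'⟩ := order_eq_shade_add_degree hroot W t ho
    have hss' : s' = s := by
      have h1 := hconst t ht
      rw [hs', hs] at h1
      exact_mod_cast h1
    rw [ho, hos', hss', hsq, hρ t ht]

end Rigidity

end Summit.ResolutionOfSingularities.ResolutionOfSingularities.Theorems.BoundaryLedger
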